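import Literature.Analysis.FluidPDE.DivCurlLiouvilleBounded
import HarnessLib

/-!
# Crux `Target` (stmt-NavierStokesRegularity-1217), line `depletion_ladder`, stub S1 (registered class):
# Liouville for weakly harmonic / weakly div–curl-free fields in `L^∞ + L²`

`--supports stmt-NavierStokesRegularity-1217` (seat leafhand-ns-poloidalwindowdoor-2 g1, cell decomp-ns;
brick (P1c) of the Liouville-representation step named in this seat's census
`S1-REGISTERED-CENSUS-leafhand-2-g1.md`, evidence on the item).

The registered stub S1 lives on bounded, NON-decaying `C²` fields `u` with `curl u ∈ L²`; its reduction to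
the landed slice-class depletion constants needs the representation `u = c + K₃ ∗ curl u`. Since
`K₃ ∗ ω ∈ L² + L^∞` for `ω ∈ L²` (near/far split of the kernel), the difference `u − K₃ ∗ ω` is only
known to lie in `L^∞ + L²`, so the tree's Liouville theorem for BOUNDED weakly harmonic fields
(`exists_ae_eq_const_of_norm_le_of_forall_integral_laplacian_mul_inner_eq_zero`, KNSS 2009 Lemma 3.1) is
one class short. This file supplies the `L^∞ + L²` class, by the same mollification proof: each
mollification `φₖ ⋆ ⟪w, a⟫` is harmonic, and bounded because `φₖ ⋆` does not increase the sup norm of the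
bounded part and maps the `L²` part into `L^∞` (`ψ(t)‖g(x − t)‖ ≤ ½(ψ(t)² + ‖g(x − t)‖²)`).

* `abs_normed_convolution_inner_le_of_add` — the uniform bound on `φ ⋆ ⟪wb + wg, a⟫` for `‖wb‖ ≤ M`,
  `wg ∈ L²`.
* `exists_ae_eq_const_of_add_memLp_two_of_forall_integral_laplacian_mul_inner_eq_zero` — **Liouville in
  `L^∞ + L²`**: `w = wb + wg` a.e.-strongly measurable with `‖wb‖ ≤ M`, `wg ∈ L²`, all components weakly
  harmonic ⟹ `w` is a.e. constant.
* `IsWeaklyDivFree.exists_ae_eq_const_of_add_memLp_two_of_forall_integral_inner_curlPair_eq_zero` — the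
  `div`–`curl` form: weakly divergence free + annihilating the curl-type test fields ⟹ a.e. constant;
  `…exists_eq_const_of_continuous…` — a continuous such field IS constant.

HONEST LABEL: helper (one brick of an XL programme); closes no stub; no Navier–Stokes content; `Target`,
S3 and NS regularity remain OPEN.

References: Koch–Nadirashvili–Seregin–Šverák, Acta Math. 203 (2009), Lemma 3.1; Lemarié-Rieusset 2016,
proof of Thm. 4.4. [folklore]
-/

noncomputable section

-- the summit and its single sub-problem share the name (CONVENTIONS §1)
set_option linter.dupNamespace false

open MeasureTheory TopologicalSpace Set Function Filter Topology InnerProductSpace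
  ContinuousLinearMap Metric
open scoped RealInnerProductSpace ENNReal NNReal Convolution ContDiff Laplacian
open Literature.Analysis Literature.Analysis.FluidPDE

namespace Summit.NavierStokesRegularity.NavierStokesRegularity.Theorems.DepletionLadder.LiouvilleL2

variable {E : Type*} [NormedAddCommGroup E] [InnerProductSpace ℝ E] [FiniteDimensional ℝ E]
  [MeasurableSpace E] [BorelSpace E]

/-- **Uniform bound on the mollification of `⟪wb + wg, a⟫`**: if `‖wb‖ ≤ M` and `‖wg‖² ∈ L¹`, then for a
normed bump `φ` (with `ψ = φ.normed`, `∫ψ = 1`, `ψ² ∈ L¹`),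
`|(ψ ⋆ ⟪wb + wg, a⟫)(x)| ≤ ‖a‖ (M + ½(∫ψ² + ∫‖wg‖²))` for every `x`. [folklore] -/
theorem abs_normed_convolution_inner_le_of_add (φ : ContDiffBump (0 : E)) {wb wg : E → E} {M : ℝ}
    (hM : ∀ x, ‖wb x‖ ≤ M) (hg2 : Integrable (fun y => ‖wg y‖ ^ 2) volume) (a x : E) :
    |(φ.normed volume ⋆[lsmul ℝ ℝ, volume] fun y => ⟪wb y + wg y, a⟫) x| ≤
      ‖a‖ * (M + ((∫ t, φ.normed volume t ^ 2) + ∫ t, ‖wg t‖ ^ 2) / 2) := by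
  set ψ : E → ℝ := φ.normed volume with hψdef
  have hψc : Continuous ψ := φ.continuous_normed
  have hψs : HasCompactSupport ψ := φ.hasCompactSupport_normed
  have hψ0 : ∀ t, 0 ≤ ψ t := fun t => φ.nonneg_normed t
  have hψi : Integrable ψ volume := φ.integrable_normed
  have hψ1 : ∫ t, ψ t = 1 := φ.integral_normed
  have hψ2i : Integrable (fun t => ψ t ^ 2) volume :=
    (hψc.pow 2).integrable_of_hasCompactSupport (hψs.mono fun t ht h0 => ht (by simp [h0]))
  have hg2x : Integrable (fun t => ‖wg (x - t)‖ ^ 2) volume := hg2.comp_sub_left x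
  have hM0 : 0 ≤ M := (norm_nonneg _).trans (hM 0)
  -- the integrable pointwise bound
  set bnd : E → ℝ := fun t => ‖a‖ * (ψ t * M + (ψ t ^ 2 + ‖wg (x - t)‖ ^ 2) / 2) with hbnd
  have h34 : Integrable (fun t => (ψ t ^ 2 + ‖wg (x - t)‖ ^ 2) / 2) volume :=
    (hψ2i.add hg2x).div_const 2
  have hbi : Integrable bnd volume := ((hψi.mul_const M).add h34).const_mul ‖a‖
  have e1 : ∫ t, (ψ t * M + (ψ t ^ 2 + ‖wg (x - t)‖ ^ 2) / 2) =
      (∫ t, ψ t * M) + ∫ t, (ψ t ^ 2 + ‖wg (x - t)‖ ^ 2) / 2 := integral_add (hψi.mul_const M) h34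
  have e2 : ∫ t, (ψ t ^ 2 + ‖wg (x - t)‖ ^ 2) / 2 = ((∫ t, ψ t ^ 2) + ∫ t, ‖wg (x - t)‖ ^ 2) / 2 := by
    rw [integral_div, integral_add hψ2i hg2x]
  have e3 : ∫ t, ‖wg (x - t)‖ ^ 2 = ∫ t, ‖wg t‖ ^ 2 :=
    integral_sub_left_eq_self (fun t => ‖wg t‖ ^ 2) volume x
  have e4 : ∫ t, ψ t * M = M := by rw [integral_mul_const, hψ1, one_mul]
  have hI : ∫ t, bnd t = ‖a‖ * (M + ((∫ t, ψ t ^ 2) + ∫ t, ‖wg t‖ ^ 2) / 2) := by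
    simp only [hbnd]
    rw [integral_const_mul, e1, e4, e2, e3]
  rw [convolution_def]
  simp only [lsmul_apply, smul_eq_mul]
  have h := norm_integral_le_of_norm_le hbi (Eventually.of_forall fun t => (?_ :
    ‖ψ t * ⟪wb (x - t) + wg (x - t), a⟫‖ ≤ bnd t))
  · rw [Real.norm_eq_abs, hI] at h
    exact h
  · rw [norm_mul, Real.norm_of_nonneg (hψ0 t), inner_add_left]
    have h1 : ‖⟪wb (x - t), a⟫ + ⟪wg (x - t), a⟫‖ ≤ M * ‖a‖ + ‖wg (x - t)‖ * ‖a‖ :=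
      (norm_add_le _ _).trans (add_le_add
        ((norm_inner_le_norm _ _).trans (mul_le_mul_of_nonneg_right (hM _) (norm_nonneg _)))
        (norm_inner_le_norm _ _))
    have h2 : ψ t * ‖wg (x - t)‖ ≤ (ψ t ^ 2 + ‖wg (x - t)‖ ^ 2) / 2 := by
      nlinarith [sq_nonneg (ψ t - ‖wg (x - t)‖)]
    calc ψ t * ‖⟪wb (x - t), a⟫ + ⟪wg (x - t), a⟫‖ ≤ ψ t * (M * ‖a‖ + ‖wg (x - t)‖ * ‖a‖) :=
          mul_le_mul_of_nonneg_left h1 (hψ0 t)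
      _ = ‖a‖ * (ψ t * M + ψ t * ‖wg (x - t)‖) := by ring
      _ ≤ bnd t := by
          simp only [hbnd]
          exact mul_le_mul_of_nonneg_left (by linarith) (norm_nonneg _)

/-- **Liouville for weakly harmonic fields in `L^∞ + L²`.** Let `E` be a finite-dimensional real inner
product space with its Lebesgue measure. If `w = wb + wg : E → E` with `wb` a.e.-strongly measurable and
bounded (`‖wb‖ ≤ M`) and `wg ∈ L²`, and every component of `w` is weakly harmonic
(`∫ (Δθ) ⟪w, a⟫ = 0` for all scalar test functions `θ` and all `a`), then `w` is a.e. equal to a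
constant. Proof: the mollifications `φₖ ⋆ ⟪w, a⟫` are harmonic (weak harmonicity) and bounded
(`abs_normed_convolution_inner_le_of_add`), hence constant (`HarmonicOnNhd.apply_eq_apply_of_abs_le`),
and converge to `⟪w, a⟫` a.e. [folklore] -/
theorem exists_ae_eq_const_of_add_memLp_two_of_forall_integral_laplacian_mul_inner_eq_zero
    {w wb wg : E → E} (hw : ∀ x, w x = wb x + wg x) (hwb : AEStronglyMeasurable wb volume) {M : ℝ}
    (hM : ∀ x, ‖wb x‖ ≤ M) (hwg : MemLp wg 2 volume)
    (hharm : ∀ θ : E → ℝ, FunctionSpaces.IsTestFunctionOn (⊤ : Opens E) θ → ∀ a : E,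
      ∫ x, (Δ θ) x * ⟪w x, a⟫ = 0) :
    ∃ c : E, w =ᵐ[volume] fun _ => c := by
  set b := stdOrthonormalBasis ℝ E
  have hwbtop : MemLp wb (⊤ : ℝ≥0∞) (volume : Measure E) :=
    memLp_top_of_bound hwb M (Eventually.of_forall hM)
  have hg2 : Integrable (fun y => ‖wg y‖ ^ 2) volume :=
    (memLp_two_iff_integrable_sq_norm hwg.1).1 hwg
  have hwfun : w = fun x => wb x + wg x := funext hw
  obtain ⟨φ, hφ0, hφ2⟩ := FunctionSpaces.exists_contDiffBump_seq (E := E)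
  -- every component `⟪w, a⟫` is a.e. equal to a constant
  have hcomp : ∀ a : E, ∃ c : ℝ, ∀ᵐ y ∂(volume : Measure E), ⟪w y, a⟫ = c := by
    intro a
    set wa : E → ℝ := fun y => ⟪w y, a⟫ with hwa_def
    have hwa' : wa = fun y => ⟪wb y, a⟫ + ⟪wg y, a⟫ := by
      funext y; simp only [hwa_def, hw y, inner_add_left]
    have hwal : LocallyIntegrable wa volume := by
      have h1 : LocallyIntegrable (fun y => ⟪wb y, a⟫) volume :=
        (hwbtop.inner_const a).locallyIntegrable le_top
      have h2 : LocallyIntegrable (fun y => ⟪wg y, a⟫) volume :=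
        (hwg.inner_const a).locallyIntegrable (by norm_num)
      rw [hwa']
      exact h1.add h2
    -- each mollification is a bounded harmonic function, hence constant
    have hconst : ∀ (k : ℕ) (x : E), ((φ k).normed volume ⋆[lsmul ℝ ℝ, volume] wa) x =
        ((φ k).normed volume ⋆[lsmul ℝ ℝ, volume] wa) 0 := by
      intro k
      set ψ : E → ℝ := (φ k).normed volume with hψ_def
      have hψ : FunctionSpaces.IsTestFunctionOn (⊤ : Opens E) ψ :=
        FunctionSpaces.isTestFunctionOn_normed (φ k)
      have hψ2 : ContDiff ℝ 2 ψ := contDiff_infty.1 hψ.contDiff 2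
      have hh2 : ContDiff ℝ 2 (ψ ⋆[lsmul ℝ ℝ, volume] wa) :=
        hψ.hasCompactSupport.contDiff_convolution_left _ hψ2 hwal
      have hΔ : ∀ x, Δ (ψ ⋆[lsmul ℝ ℝ, volume] wa) x = 0 := by
        intro x
        rw [laplacian_convolution_lsmul hψ2 hψ.hasCompactSupport hwal x, convolution_def]
        simp only [lsmul_apply, smul_eq_mul]
        have e := integral_sub_left_eq_self (fun t => (Δ ψ) t * wa (x - t)) volume x
        simp only [sub_sub_cancel] at e
        rw [← e]
        have hθ : FunctionSpaces.IsTestFunctionOn (⊤ : Opens E) (fun z => ψ (x - z)) :=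
          hψ.comp_sub_left x
        have key := hharm _ hθ a
        simp_rw [laplacian_comp_sub_left hψ2 x] at key
        exact key
      have hharm' : HarmonicOnNhd (ψ ⋆[lsmul ℝ ℝ, volume] wa) univ := fun x _ =>
        ⟨hh2.contDiffAt, Eventually.of_forall fun y => hΔ y⟩
      have hbdd : ∀ x, |(ψ ⋆[lsmul ℝ ℝ, volume] wa) x| ≤
          ‖a‖ * (M + ((∫ t, (φ k).normed volume t ^ 2) + ∫ t, ‖wg t‖ ^ 2) / 2) := by
        intro x
        have h := abs_normed_convolution_inner_le_of_add (φ k) hM hg2 a x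
        have hwa'' : wa = fun y => ⟪wb y + wg y, a⟫ := by
          funext y; simp only [hwa_def, hw y]
        rw [hψ_def, hwa'']
        exact h
      exact fun x => hharm'.apply_eq_apply_of_abs_le hbdd x 0
    -- the constants converge to `⟪w, a⟫` a.e.
    have hlim := FunctionSpaces.ae_tendsto_normed_convolution hφ0 hφ2 hwal
    refine ⟨limUnder atTop fun k => ((φ k).normed volume ⋆[lsmul ℝ ℝ, volume] wa) 0, ?_⟩
    filter_upwards [hlim] with x hx
    simp_rw [hconst] at hx
    exact (hx.limUnder_eq).symm
  -- assemble along an orthonormal frame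
  choose c hc using hcomp
  have hall : ∀ᵐ y ∂(volume : Measure E), ∀ i, ⟪w y, b i⟫ = c (b i) :=
    ae_all_iff.2 fun i => hc (b i)
  refine ⟨∑ i, c (b i) • b i, ?_⟩
  filter_upwards [hall] with y hy
  rw [← b.sum_repr' (w y)]
  exact Finset.sum_congr rfl fun i _ => by rw [real_inner_comm, hy i]

/-- **The `div`–`curl` annihilator lemma in `L^∞ + L²`.** If `w = wb + wg : E → E` (`wb` a.e.-strongly
measurable and bounded, `wg ∈ L²`) is weakly divergence free and annihilates every curl-type field
`(∂ₐg) c − (∂_c g) a` (`g` a scalar test function), then `w` is a.e. constant: its components are weakly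
harmonic (tree `integral_laplacian_mul_inner_eq_zero_of_curlPair`) and the previous lemma applies. [folklore] -/
theorem exists_ae_eq_const_of_add_memLp_two_of_forall_integral_inner_curlPair_eq_zero
    {w wb wg : E → E} (hw : ∀ x, w x = wb x + wg x) (hwb : AEStronglyMeasurable wb volume) {M : ℝ}
    (hM : ∀ x, ‖wb x‖ ≤ M) (hwg : MemLp wg 2 volume) (hdiv : IsWeaklyDivFree w)
    (hcurl : ∀ g : E → ℝ, FunctionSpaces.IsTestFunctionOn (⊤ : Opens E) g → ∀ a c : E,
      ∫ x, ⟪w x, fderiv ℝ g x a • c - fderiv ℝ g x c • a⟫ = 0) :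
    ∃ c : E, w =ᵐ[volume] fun _ => c := by
  have hwl : LocallyIntegrable w (volume : Measure E) := by
    have h1 : LocallyIntegrable wb volume :=
      (memLp_top_of_bound hwb M (Eventually.of_forall hM)).locallyIntegrable le_top
    have h2 : LocallyIntegrable wg volume := hwg.locallyIntegrable (by norm_num)
    rw [show w = fun x => wb x + wg x from funext hw]
    exact h1.add h2
  exact exists_ae_eq_const_of_add_memLp_two_of_forall_integral_laplacian_mul_inner_eq_zero hw hwb hM
    hwg fun _ hθ a => integral_laplacian_mul_inner_eq_zero_of_curlPair hwl hdiv hcurl hθ a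

/-- **Continuous version**: a continuous field `w = wb + wg` (`wb` bounded measurable, `wg ∈ L²`) which is
weakly divergence free and annihilates the curl-type fields IS constant (two continuous functions that
agree a.e. agree). This is the form needed for `u − K₃ ∗ curl u` with `u` bounded continuous and
`K₃ ∗ curl u ∈ L^∞ + L²`. [folklore] -/
theorem exists_eq_const_of_continuous_of_add_memLp_two_of_forall_integral_inner_curlPair_eq_zero
    {w wb wg : E → E} (hwc : Continuous w) (hw : ∀ x, w x = wb x + wg x)
    (hwb : AEStronglyMeasurable wb volume) {M : ℝ} (hM : ∀ x, ‖wb x‖ ≤ M) (hwg : MemLp wg 2 volume)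
    (hdiv : IsWeaklyDivFree w)
    (hcurl : ∀ g : E → ℝ, FunctionSpaces.IsTestFunctionOn (⊤ : Opens E) g → ∀ a c : E,
      ∫ x, ⟪w x, fderiv ℝ g x a • c - fderiv ℝ g x c • a⟫ = 0) :
    ∃ c : E, w = fun _ => c := by
  obtain ⟨c, hc⟩ :=
    exists_ae_eq_const_of_add_memLp_two_of_forall_integral_inner_curlPair_eq_zero hw hwb hM hwg hdiv hcurl
  exact ⟨c, (hwc.ae_eq_iff_eq volume continuous_const).1 hc⟩

end Summit.NavierStokesRegularity.NavierStokesRegularity.Theorems.DepletionLadder.LiouvilleL2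

end
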